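import Literature.Analysis.DeBrangesSpaces.BurnolSonineSpaces
import Literature.NumberTheory.LFunctions.BurnolSonineDensityProofs
import Mathlib.MeasureTheory.Function.JacobianOneDim
import HarnessLib

/-!
# Burnol 2001 (CRAS 333), Prop. 2.1: `⋂ H_Λ = {0}` and `closure ⋃ H_Λ = K` — DISCHARGE of
# `Burnol2001CRAS_prop2_1`

LINE 1 — LABEL: RH-FREE (`L²` bookkeeping about the spaces `H_Λ = L²((0,Λ)) ∩ 𝒢(L²((0,Λ)))` and the
unitary involution `I f(t) = f(1/t)/|t|`; the Riemann zeta function does not occur). FRAMING (cell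
rh-crit, D-0074): corpus theorems are RH-FREE literature; nothing here is worded as progress toward RH.
bears_on: B-C/B-P (LADDER-RH COLUMN 6, de Branges framework). WHAT THIS IS NOT: not a route, not a
criterion; nothing here bears on the truth of RH.

Source: J.-F. Burnol, *Sur certains espaces de Hilbert de fonctions entières, liés à la transformation de
Fourier et aux fonctions L de Dirichlet et de Riemann*, C. R. Acad. Sci. Paris Sér. I **333** (2001)
201–206 = arXiv:math/0105120 [Burnol2001CRAS], §2, Proposition 2.1 (TeX of record
`dbl/src/Burnol2001CRAS_arXivmath0105120.tex` l.427–428): *On a `⋂ H_Λ = {0}` et `closure(⋃ H_Λ) = K`*,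
typed in `BurnolSonineSpaces.lean` as the named fact `Burnol2001.Burnol2001CRAS_prop2_1` over
`Burnol2001.memHLambda` ("`H_Λ` = even classes a.e. zero for `|t| > Λ` whose image under
`I f(t) = f(1/t)/|t|` has cosine transform a.e. zero on `|t| < 1/Λ`", i.e. `H_Λ = I K_{1/Λ}`, TeX l.410–418).

## What is PROVED (theorem-only module: no definition, no named fact)

* `Burnol2001.Burnol2001CRAS_prop2_1_holds : Burnol2001CRAS_prop2_1`.

Proof. (i) `⋂_Λ H_Λ = {0}`: a class vanishing a.e. on `|t| > 1/(n+1)` for every `n` vanishes a.e. (the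
printed "On a" — immediate from the definition). (ii) `K ⊆ closure ⋃_Λ H_Λ`: this is the transport under
the unitary involution `I` ("`I` est unitaire", TeX l.302; "`H_Λ = I K_{λ,λ}` avec `λ = 1/Λ`", TeX l.418) of
the density of `⋃_{λ>0} K_λ` in `K`, which is Burnol 2004, Prop. 6.6 (iii), a kernel theorem of the tree
(`Literature.NumberTheory.LFunctions.Burnol2004_prop_6_6_holds`, `BurnolSonineDensityProofs.lean`). The
`L²` isometry `‖If‖ = ‖f‖` is the change of variables `u = 1/t` on `ℝ ∖ {0}` (Mathlib's one-dimensional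
Jacobian formula `MeasureTheory.integral_image_eq_integral_abs_deriv_smul`), and a.e. statements are
transported along `t ↦ 1/t` by its quasi-measure-preservation (images of null sets under a map
differentiable on them are null, `MeasureTheory.addHaar_image_eq_zero_of_differentiableOn_of_addHaar_eq_zero`).
No operator `I` is defined: the transform of `k` is the class of `t ↦ k(t⁻¹)/|t|`, exactly the shape used
by `memHLambda`.

## References
* [Burnol2001CRAS] C. R. Acad. Sci. Paris Sér. I 333 (2001) 201–206, §2, Prop. 2.1 (TeX l.427–428),
  §1 (TeX l.302: `I` unitary), §2 (TeX l.410–418: `H_Λ = I K_{1/Λ}`).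
* [Burnol2004] Forum Math. 16 (2004) 789–840, Prop. 6.6 (the density of `⋃ K_λ`, tree theorem).
-/

noncomputable section

open _root_.MeasureTheory _root_.Set _root_.Filter FourierTransform
open scoped Topology ENNReal
open Literature.NumberTheory.LFunctions Literature.Analysis.FunctionSpaces

namespace Literature.Analysis.DeBrangesSpaces

namespace Burnol2001

section InversionTransport

/-! ### The inversion `t ↦ 1/t` on `(ℝ, dt)`: quasi-measure-preservation and the `L²` isometry
`f ↦ f(1/t)/|t|` -/

/-- `t ↦ t⁻¹` is quasi-measure-preserving for Lebesgue measure (null sets have null preimages: off `0`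
the map is differentiable, so it sends null sets to null sets). [folklore] -/
private theorem quasiMeasurePreserving_inv_real :
    Measure.QuasiMeasurePreserving (fun t : ℝ ↦ t⁻¹) volume volume := by
  refine ⟨measurable_inv, Measure.AbsolutelyContinuous.mk fun N hN hN0 ↦ ?_⟩
  rw [Measure.map_apply measurable_inv hN]
  have hsub : (fun t : ℝ ↦ t⁻¹) ⁻¹' N ⊆ (fun t : ℝ ↦ t⁻¹) '' (N \ {0}) ∪ {0} := by
    intro t ht
    by_cases ht0 : t = 0
    · exact Or.inr ht0
    · exact Or.inl ⟨t⁻¹, ⟨ht, inv_ne_zero ht0⟩, inv_inv t⟩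
  have hdiff : DifferentiableOn ℝ (fun t : ℝ ↦ t⁻¹) (N \ {0}) :=
    fun t ht ↦ (hasDerivAt_inv ht.2).differentiableAt.differentiableWithinAt
  have h1 : volume ((fun t : ℝ ↦ t⁻¹) '' (N \ {0})) = 0 :=
    addHaar_image_eq_zero_of_differentiableOn_of_addHaar_eq_zero volume hdiff
      (measure_mono_null (fun x hx ↦ hx.1) hN0)
  exact measure_mono_null hsub (measure_union_null h1 (measure_singleton 0))

/-- Almost every real number is non-zero. [folklore] -/
private theorem ae_ne_zero_real : ∀ᵐ t : ℝ, t ≠ 0 := by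
  have : ({0}ᶜ : Set ℝ) ∈ ae (volume : Measure ℝ) := compl_mem_ae_iff.2 (measure_singleton 0)
  filter_upwards [this] with t ht
  exact ht

/-- `ℝ ∖ {0}` has full measure. [folklore] -/
private theorem compl_zero_ae_eq_univ : (({0}ᶜ : Set ℝ)) =ᵐ[volume] (univ : Set ℝ) :=
  ae_eq_univ.2 (by rw [compl_compl]; exact measure_singleton (0 : ℝ))

/-- The image of `ℝ ∖ {0}` under `t ↦ t⁻¹` is `ℝ ∖ {0}`. [folklore] -/
private theorem image_inv_compl_zero :
    (fun t : ℝ ↦ t⁻¹) '' ({0}ᶜ : Set ℝ) = ({0}ᶜ : Set ℝ) := by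
  ext x
  simp only [mem_image, mem_compl_iff, mem_singleton_iff]
  constructor
  · rintro ⟨t, ht, rfl⟩
    exact inv_ne_zero ht
  · intro hx
    exact ⟨x⁻¹, inv_ne_zero hx, inv_inv x⟩

/-- The pointwise identity `‖k(t⁻¹)/|t|‖² = |−(t²)⁻¹| · ‖k(t⁻¹)‖²` (also at `t = 0`, where both sides
vanish in Lean's conventions `0⁻¹ = 0`, `x/0 = 0`). [folklore] -/
private theorem norm_sq_invT_eq (k : ℝ → ℂ) (t : ℝ) :
    ‖k t⁻¹ / ((|t| : ℝ) : ℂ)‖ ^ 2 = |(-(t ^ 2)⁻¹ : ℝ)| • ‖k t⁻¹‖ ^ 2 := by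
  rw [norm_div, Complex.norm_real, Real.norm_eq_abs, abs_abs, div_pow, abs_neg, abs_inv, abs_pow,
    sq_abs, smul_eq_mul]
  ring

/-- **The inversion `k ↦ k(1/t)/|t|` preserves `L²(ℝ)`** (change of variables `u = 1/t`, Jacobian `t⁻²`).
[cite: Burnol2001CRAS, §1 (TeX l.302: "`I` est unitaire")] -/
private theorem memLp_invT (k : Lp ℂ 2 (volume : Measure ℝ)) :
    MemLp (fun t : ℝ ↦ (k : ℝ → ℂ) t⁻¹ / ((|t| : ℝ) : ℂ)) 2 volume := by
  have hmeas : AEStronglyMeasurable (fun t : ℝ ↦ (k : ℝ → ℂ) t⁻¹ / ((|t| : ℝ) : ℂ)) volume := by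
    have h1 : AEStronglyMeasurable (fun t : ℝ ↦ (k : ℝ → ℂ) t⁻¹) volume :=
      (Lp.aestronglyMeasurable k).comp_quasiMeasurePreserving quasiMeasurePreserving_inv_real
    have h2 : AEStronglyMeasurable (fun t : ℝ ↦ (((|t| : ℝ) : ℂ))⁻¹) volume :=
      (Complex.continuous_ofReal.measurable.comp measurable_abs).inv.aestronglyMeasurable
    exact (h1.mul h2).congr (Eventually.of_forall fun t ↦ (div_eq_mul_inv _ _).symm)
  rw [memLp_two_iff_integrable_sq_norm hmeas]
  -- integrability of `‖k(t⁻¹)‖²/t²` on `ℝ ∖ {0}` = integrability of `‖k‖²` on the image `ℝ ∖ {0}`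
  have hG : Integrable (fun x : ℝ ↦ ‖(k : ℝ → ℂ) x‖ ^ 2) volume := integrable_sq_norm_Lp k
  have hderiv : ∀ t ∈ ({0}ᶜ : Set ℝ), HasDerivWithinAt (fun t : ℝ ↦ t⁻¹) (-(t ^ 2)⁻¹) ({0}ᶜ : Set ℝ) t :=
    fun t ht ↦ (hasDerivAt_inv ht).hasDerivWithinAt
  have hinj : InjOn (fun t : ℝ ↦ t⁻¹) ({0}ᶜ : Set ℝ) := inv_injective.injOn
  have hOn : IntegrableOn (fun t : ℝ ↦ |(-(t ^ 2)⁻¹ : ℝ)| • ‖(k : ℝ → ℂ) t⁻¹‖ ^ 2) ({0}ᶜ : Set ℝ) := by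
    rw [← integrableOn_image_iff_integrableOn_abs_deriv_smul (measurableSet_singleton 0).compl hderiv
      hinj (fun x : ℝ ↦ ‖(k : ℝ → ℂ) x‖ ^ 2), image_inv_compl_zero]
    exact hG.integrableOn
  have hOn' : IntegrableOn (fun t : ℝ ↦ ‖(k : ℝ → ℂ) t⁻¹ / ((|t| : ℝ) : ℂ)‖ ^ 2) ({0}ᶜ : Set ℝ) :=
    hOn.congr_fun (fun t _ ↦ (norm_sq_invT_eq _ t).symm) (measurableSet_singleton 0).compl
  have huniv : IntegrableOn (fun t : ℝ ↦ ‖(k : ℝ → ℂ) t⁻¹ / ((|t| : ℝ) : ℂ)‖ ^ 2) (univ : Set ℝ) :=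
    hOn'.congr_set_ae compl_zero_ae_eq_univ.symm
  exact integrableOn_univ.1 huniv

/-- **`I` is an isometry of `L²(ℝ)`**: `∫ |k(1/t)|²/t² dt = ∫ |k(u)|² du`.
[cite: Burnol2001CRAS, §1 (TeX l.302: "`I` est unitaire")] -/
private theorem norm_toLp_invT (k : Lp ℂ 2 (volume : Measure ℝ)) :
    ‖(memLp_invT k).toLp (fun t : ℝ ↦ (k : ℝ → ℂ) t⁻¹ / ((|t| : ℝ) : ℂ))‖ = ‖k‖ := by
  have hsq : ‖(memLp_invT k).toLp (fun t : ℝ ↦ (k : ℝ → ℂ) t⁻¹ / ((|t| : ℝ) : ℂ))‖ ^ 2 = ‖k‖ ^ 2 := by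
    rw [norm_sq_eq_integral_Lp_two, norm_sq_eq_integral_Lp_two]
    have hae := (memLp_invT k).coeFn_toLp
    calc ∫ t, ‖((memLp_invT k).toLp (fun t : ℝ ↦ (k : ℝ → ℂ) t⁻¹ / ((|t| : ℝ) : ℂ)) : ℝ → ℂ) t‖ ^ 2
        = ∫ t, ‖(k : ℝ → ℂ) t⁻¹ / ((|t| : ℝ) : ℂ)‖ ^ 2 := by
          refine integral_congr_ae ?_
          filter_upwards [hae] with t ht
          rw [ht]
      _ = ∫ t in ({0}ᶜ : Set ℝ), ‖(k : ℝ → ℂ) t⁻¹ / ((|t| : ℝ) : ℂ)‖ ^ 2 := by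
          rw [← setIntegral_univ]
          exact setIntegral_congr_set compl_zero_ae_eq_univ.symm
      _ = ∫ t in ({0}ᶜ : Set ℝ), |(-(t ^ 2)⁻¹ : ℝ)| • ‖(k : ℝ → ℂ) t⁻¹‖ ^ 2 := by
          refine setIntegral_congr_fun (measurableSet_singleton 0).compl fun t _ ↦ ?_
          exact norm_sq_invT_eq _ t
      _ = ∫ x in (fun t : ℝ ↦ t⁻¹) '' ({0}ᶜ : Set ℝ), ‖(k : ℝ → ℂ) x‖ ^ 2 :=
          (integral_image_eq_integral_abs_deriv_smul (measurableSet_singleton 0).compl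
            (fun t ht ↦ (hasDerivAt_inv ht).hasDerivWithinAt) inv_injective.injOn
            (fun x : ℝ ↦ ‖(k : ℝ → ℂ) x‖ ^ 2)).symm
      _ = ∫ x, ‖(k : ℝ → ℂ) x‖ ^ 2 := by
          rw [image_inv_compl_zero]
          exact (setIntegral_congr_set (f := fun x : ℝ ↦ ‖(k : ℝ → ℂ) x‖ ^ 2)
            compl_zero_ae_eq_univ).trans setIntegral_univ
  have h1 : 0 ≤ ‖(memLp_invT k).toLp (fun t : ℝ ↦ (k : ℝ → ℂ) t⁻¹ / ((|t| : ℝ) : ℂ))‖ := norm_nonneg _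
  have h2 : 0 ≤ ‖k‖ := norm_nonneg _
  nlinarith [hsq, h1, h2, sq_nonneg (‖(memLp_invT k).toLp (fun t : ℝ ↦ (k : ℝ → ℂ) t⁻¹ /
    ((|t| : ℝ) : ℂ))‖ - ‖k‖)]

/-- **`I` is an involution** (a.e. form, the shape of the `g`-clause of `memHLambda`): with `f = Ik`,
`k(t) = f(t⁻¹)/|t|` for a.e. `t`. [cite: Burnol2001CRAS, §1–2 (TeX l.302, 410–418)] -/
private theorem ae_invT_invT (k : Lp ℂ 2 (volume : Measure ℝ)) :
    ∀ᵐ t : ℝ, (k : ℝ → ℂ) t =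
      ((memLp_invT k).toLp (fun t : ℝ ↦ (k : ℝ → ℂ) t⁻¹ / ((|t| : ℝ) : ℂ)) : ℝ → ℂ) t⁻¹ /
        ((|t| : ℝ) : ℂ) := by
  have hae := (memLp_invT k).coeFn_toLp
  have hae' := quasiMeasurePreserving_inv_real.ae hae
  filter_upwards [hae', ae_ne_zero_real] with t ht ht0
  rw [ht, inv_inv, abs_inv]
  have h : ((|t| : ℝ) : ℂ) ≠ 0 := by exact_mod_cast (abs_pos.2 ht0).ne'
  push_cast
  field_simp

/-- The involution at the level of `L²` classes: `I(Ik) = k`. [cite: Burnol2001CRAS, §1 (TeX l.302)] -/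
private theorem toLp_invT_invT (k : Lp ℂ 2 (volume : Measure ℝ)) :
    (memLp_invT ((memLp_invT k).toLp (fun t : ℝ ↦ (k : ℝ → ℂ) t⁻¹ / ((|t| : ℝ) : ℂ)))).toLp
      (fun t : ℝ ↦ ((memLp_invT k).toLp (fun t : ℝ ↦ (k : ℝ → ℂ) t⁻¹ / ((|t| : ℝ) : ℂ)) : ℝ → ℂ) t⁻¹ /
        ((|t| : ℝ) : ℂ)) = k := by
  apply Lp.ext
  filter_upwards [MemLp.coeFn_toLp (memLp_invT ((memLp_invT k).toLp
    (fun t : ℝ ↦ (k : ℝ → ℂ) t⁻¹ / ((|t| : ℝ) : ℂ)))), ae_invT_invT k] with t ht ht'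
  rw [ht, ← ht']

/-- `I` commutes with subtraction (a.e. pointwise, hence in `L²`). [folklore] -/
private theorem toLp_invT_sub (k h : Lp ℂ 2 (volume : Measure ℝ)) :
    (memLp_invT (k - h)).toLp (fun t : ℝ ↦ ((k - h : Lp ℂ 2 (volume : Measure ℝ)) : ℝ → ℂ) t⁻¹ /
        ((|t| : ℝ) : ℂ)) =
      (memLp_invT k).toLp (fun t : ℝ ↦ (k : ℝ → ℂ) t⁻¹ / ((|t| : ℝ) : ℂ)) -
        (memLp_invT h).toLp (fun t : ℝ ↦ (h : ℝ → ℂ) t⁻¹ / ((|t| : ℝ) : ℂ)) := by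
  apply Lp.ext
  have hsub := quasiMeasurePreserving_inv_real.ae (Lp.coeFn_sub k h)
  filter_upwards [(memLp_invT (k - h)).coeFn_toLp, hsub,
    Lp.coeFn_sub ((memLp_invT k).toLp (fun t : ℝ ↦ (k : ℝ → ℂ) t⁻¹ / ((|t| : ℝ) : ℂ)))
      ((memLp_invT h).toLp (fun t : ℝ ↦ (h : ℝ → ℂ) t⁻¹ / ((|t| : ℝ) : ℂ))),
    (memLp_invT k).coeFn_toLp, (memLp_invT h).coeFn_toLp] with t h1 h2 h3 h4 h5
  rw [h1, h3, Pi.sub_apply, h4, h5, h2, Pi.sub_apply, sub_div]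

/-- `‖Ik − Ih‖ = ‖k − h‖`. [cite: Burnol2001CRAS, §1 (TeX l.302: "`I` est unitaire")] -/
private theorem norm_toLp_invT_sub (k h : Lp ℂ 2 (volume : Measure ℝ)) :
    ‖(memLp_invT k).toLp (fun t : ℝ ↦ (k : ℝ → ℂ) t⁻¹ / ((|t| : ℝ) : ℂ)) -
        (memLp_invT h).toLp (fun t : ℝ ↦ (h : ℝ → ℂ) t⁻¹ / ((|t| : ℝ) : ℂ))‖ = ‖k - h‖ := by
  rw [← toLp_invT_sub, norm_toLp_invT]

/-- `I` preserves evenness. [folklore] -/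
private theorem toLp_invT_mem_evenL2 {k : Lp ℂ 2 (volume : Measure ℝ)} (hk : k ∈ evenL2) :
    (memLp_invT k).toLp (fun t : ℝ ↦ (k : ℝ → ℂ) t⁻¹ / ((|t| : ℝ) : ℂ)) ∈ evenL2 := by
  have hk' : ∀ᵐ u : ℝ, (k : ℝ → ℂ) (-u) = (k : ℝ → ℂ) u := hk
  have hneg : Measure.QuasiMeasurePreserving (fun x : ℝ ↦ -x) volume volume :=
    (Measure.measurePreserving_neg (volume : Measure ℝ)).quasiMeasurePreserving
  have hae := (memLp_invT k).coeFn_toLp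
  have hae' := hneg.ae hae
  have hk'' := quasiMeasurePreserving_inv_real.ae hk'
  simp only [evenL2, Set.mem_setOf_eq]
  filter_upwards [hae, hae', hk''] with t h1 h2 h3
  rw [h2, h1, inv_neg, h3, abs_neg]

/-- **`I` maps `K_λ` into `H_{1/λ}`** ("`H_Λ = I K_{λ,λ}` avec `λ = 1/Λ`"): for `k ∈ K_λ`, `λ > 0`, the class
`Ik` of `t ↦ k(t⁻¹)/|t|` satisfies `memHLambda λ⁻¹`, with witness `g = k` for the `𝒢`-clause.
[cite: Burnol2001CRAS, §2 (TeX l.410–418)] -/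
private theorem memHLambda_toLp_invT {lam : ℝ} (hlam : 0 < lam) {k : Lp ℂ 2 (volume : Measure ℝ)}
    (hk : k ∈ sonineK lam) :
    memHLambda lam⁻¹ ((memLp_invT k).toLp (fun t : ℝ ↦ (k : ℝ → ℂ) t⁻¹ / ((|t| : ℝ) : ℂ))) := by
  obtain ⟨hke, hk0, hk1⟩ := hk
  have hke' : ∀ᵐ u : ℝ, (k : ℝ → ℂ) (-u) = (k : ℝ → ℂ) u := hke
  have hneg : Measure.QuasiMeasurePreserving (fun x : ℝ ↦ -x) volume volume :=
    (Measure.measurePreserving_neg (volume : Measure ℝ)).quasiMeasurePreserving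
  -- `k = 0` a.e. on `|u| < λ` (two-sided, from evenness)
  have hk0' : ∀ᵐ u : ℝ, |u| < lam → u ≠ 0 → (k : ℝ → ℂ) u = 0 := by
    have h := hneg.ae hk0
    filter_upwards [hk0, h, hke'] with u h1 h2 h3 hu hu0
    rcases lt_or_gt_of_ne hu0 with hneg' | hpos
    · rw [← h3]
      exact h2 ⟨by linarith, by rw [abs_of_neg hneg'] at hu; linarith⟩
    · exact h1 ⟨hpos, by rwa [abs_of_pos hpos] at hu⟩
  have hae := (memLp_invT k).coeFn_toLp
  refine ⟨toLp_invT_mem_evenL2 hke, ?_, ⟨k, ae_invT_invT k, ?_⟩⟩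
  · -- vanishing for `|t| > 1/λ`
    have h := quasiMeasurePreserving_inv_real.ae hk0'
    filter_upwards [hae, h] with t h1 h2 ht
    have ht0 : t ≠ 0 := by
      rintro rfl
      rw [abs_zero] at ht
      exact absurd ht (not_lt.2 (inv_pos.2 hlam).le)
    have hlt : |t⁻¹| < lam := by
      rw [abs_inv]
      calc |t|⁻¹ < lam⁻¹⁻¹ := by
            apply inv_strictAnti₀ (inv_pos.2 hlam) ht
        _ = lam := inv_inv lam
    rw [h1, h2 hlt (inv_ne_zero ht0), zero_div]
  · -- the cosine transform of `g = k` vanishes on `|t| < (1/λ)⁻¹ = λ`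
    rw [inv_inv]
    have hFe : ∀ᵐ u : ℝ, ((𝓕 k : Lp ℂ 2 (volume : Measure ℝ)) : ℝ → ℂ) (-u) =
        ((𝓕 k : Lp ℂ 2 (volume : Measure ℝ)) : ℝ → ℂ) u := fourier_mem_evenL2 hke
    have h := hneg.ae hk1
    filter_upwards [hk1, h, hFe, ae_ne_zero_real] with u h1 h2 h3 hu0 hu
    rcases lt_or_gt_of_ne hu0 with hneg' | hpos
    · rw [← h3]
      exact h2 ⟨by linarith, by rw [abs_of_neg hneg'] at hu; linarith⟩
    · exact h1 ⟨hpos, by rwa [abs_of_pos hpos] at hu⟩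

end InversionTransport

/-! ### The discharge -/

/-- **Proposition 2.1 holds**: `⋂_Λ H_Λ = {0}` and `closure (⋃_Λ H_Λ) = K` (the even square-integrable
classes). (i) is immediate from the definition of `H_Λ`; (ii) is Burnol 2004, Prop. 6.6 (iii) (the density
of `⋃_{λ>0} K_λ` in `K`, tree theorem `Burnol2004_prop_6_6_holds`) transported by the unitary involution
`I`, `H_Λ = I K_{1/Λ}`. [cite: Burnol2001CRAS, Proposition 2.1 (TeX l.427–428), §2 (TeX l.410–418); Burnol2004, Prop. 6.6] -/
theorem Burnol2001CRAS_prop2_1_holds : Burnol2001CRAS_prop2_1 := by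
  refine ⟨fun f hf ↦ ?_, fun h hh ↦ ?_⟩
  · -- (i) `⋂ H_Λ = {0}`
    have hn : ∀ n : ℕ, ∀ᵐ t : ℝ, (1 : ℝ) / ((n : ℝ) + 1) < |t| → (f : ℝ → ℂ) t = 0 :=
      fun n ↦ (hf _ (by positivity)).2.1
    have hall := ae_all_iff.2 hn
    apply Lp.ext
    filter_upwards [hall, ae_ne_zero_real, Lp.coeFn_zero ℂ 2 (volume : Measure ℝ)] with t ht ht0 hz
    rw [hz, Pi.zero_apply]
    obtain ⟨n, hn'⟩ := exists_nat_one_div_lt (abs_pos.2 ht0)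
    exact ht n hn'
  · -- (ii) `K ⊆ closure ⋃ H_Λ`
    set h' : Lp ℂ 2 (volume : Measure ℝ) :=
      (memLp_invT h).toLp (fun t : ℝ ↦ (h : ℝ → ℂ) t⁻¹ / ((|t| : ℝ) : ℂ)) with hh'_def
    have hh' : h' ∈ evenL2 := toLp_invT_mem_evenL2 hh
    have hcl : h' ∈ closure (⋃ lam ∈ Set.Ioi (0 : ℝ), sonineK lam) := by
      have e : closure (⋃ lam ∈ Set.Ioi (0 : ℝ), sonineK lam) = evenL2 := Burnol2004_prop_6_6_holds
      rw [e]
      exact hh'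
    rw [Metric.mem_closure_iff] at hcl ⊢
    intro ε hε
    obtain ⟨k, hk, hdist⟩ := hcl ε hε
    obtain ⟨lam, hlam, hk⟩ := Set.mem_iUnion₂.1 hk
    have hlam' : 0 < lam := hlam
    refine ⟨(memLp_invT k).toLp (fun t : ℝ ↦ (k : ℝ → ℂ) t⁻¹ / ((|t| : ℝ) : ℂ)),
      ⟨lam⁻¹, inv_pos.2 hlam', memHLambda_toLp_invT hlam' hk⟩, ?_⟩
    have hinv : (memLp_invT h').toLp (fun t : ℝ ↦ (h' : ℝ → ℂ) t⁻¹ / ((|t| : ℝ) : ℂ)) = h := by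
      rw [hh'_def]
      exact toLp_invT_invT h
    rw [dist_eq_norm, ← hinv, norm_toLp_invT_sub, ← dist_eq_norm]
    exact hdist

end Burnol2001

end Literature.Analysis.DeBrangesSpaces
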